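import Summits.QuantumFields.YangMills.Theorems.BalabanUVNodesN11RunGuardOfFlowControl
import Summits.QuantumFields.YangMills.Theorems.BalabanUVNodesN11OneBlockLevels

/-!
# DAG node N11 — THE STAIRCASE NORMAL FORM OF A (2.18) HISTORY: along ANY (2.1)-chain the levels where `Ω_j` (resp. `Λ_j`) is the whole torus form initial segments `[1, cΩ]`,
# `[1, cΛ]` with `cΛ ≤ cΩ ≤ cΛ + 1`; on an ALL-ONE-BLOCK run (every 𝐃_j-cube exceeds the torus) the other levels are EMPTY, so a history IS its pair of codes `(cΩ, cΛ)` and the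
# (2.18) index set of length `k` has AT MOST `2k + 1` elements

HEADER — WORK-UNIT METADATA.  Cell `pub-ymgap`, YM-PLAN Track A (HUMAN RULING D-0062 ∕ D-0149 width seats), seat `pub-ymgap-dag-n11-w4` (g5; WIDTH SEAT 4 of 4 on NODE n11
[B14]), route `BalabanUVNodes` rev 29, deciding item K1⁹ `StabilityBRunRowsAtRecordR13SepCoPHV` = stmt-QuantumFields-27364 (helper lane, `--kind proof --supports 27364 --as helper`,
count-neutral).  [III] = [Balaban1988Convergent].  Over this seat's p630366 `…N11RunGuardOfFlowControl` (`not_dvdAt_mono_of_flowIneq26`), p618164 `…N11OneBlockLevels`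
(`eq_empty_or_eq_univ_of_mem_unionsOfCubes_of_le`, `dCubeSide_dvd_or_lt`; companion of this seat's `…N11OneBlockTailHistories`), r11's
`B14.Eq218Concrete.Seq ∕ Chain21` (`ext'`, `Ω_off`, `Λ_off`, antitone lemmas, the `Fintype` instance of the (2.18) index).

WHY THIS FILE.  `…N11OneBlockTailHistories` typed the per-level trichotomy on one-block levels.  Globally, for ANY (2.1)-chain `Λ_j ⊆ Ω_j`, `Ω_{j+1} ⊆ Λ_j` the «all-small prefix»
is an initial segment: `Ω_j = T ⟺ j ≤ cΩ`, `Λ_j = T ⟺ j ≤ cΛ` with `cΛ ≤ cΩ ≤ cΛ + 1` (§1, no one-block hypothesis — print's shrinking small-field regions).  On a run all of whose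
levels are one-block (the families «entirely below the floor», p622523; `pattern_all_of_not_dvd_one_of_flowIneq26`) the remaining levels are `∅`, so the history is DETERMINED by
`(cΩ, cΛ)` (§2) and the (2.18) representation of `ρ_k` has at most `2k + 1` terms (§3: the codes `cΩ + cΛ ∈ {0, …, 2k}` are injective) — the whole large-field combinatorics of [III]
§2–§3 degenerates there to «all small up to a level, all large after».  A located size statement for the planners ∕ K1 assemblers (what K1⁹'s (B)-face asks of N11 at small families),
count-neutral.

WHAT THIS FILE PROVES (0 `sorry`, 0 `def`; standard axioms; pure combinatorics of (2.1)-chains).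
§1 (any `s : Seq D k`) ★★ `exists_staircase_codes` (`∃ cΩ cΛ ≤ k`, `cΛ ≤ cΩ ≤ cΛ + 1`, `Ω_j = T ↔ j ≤ cΩ`, `Λ_j = T ↔ j ≤ cΛ` on `1 ≤ j ≤ k`).
§2 (binary levels: `Ω_j, Λ_j ∈ {∅, T}` for `1 ≤ j ≤ k`) ★★ `eq_of_binary_of_univ_iff` (two binary histories with the same `T`-levels are EQUAL) · ★★★ `card_le_of_binary` (if EVERY index of
   length `k` is binary then `Fintype.card (Seq D k) ≤ 2k + 1`).
§3 (sequences of record) ★★★ `card_seqOfRecord_le_of_allOneBlock` (all levels `1 … k` one-block ⟹ `card ≤ 2k + 1`) · ★★★ `card_seqOfRecord_le_of_not_dvd_one_of_flowIneq26` (a windowed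
   (2.6)-run whose level-1 cube does not fit: `card ≤ 2k + 1` for every `k ≤ K`).

HONEST FRAMING.  Helper lane of K1⁹; count-neutral combinatorial bookkeeping on the tree's own (2.1)-chains; (2.6), the window, `M = L^a` are HYPOTHESES where used; nothing of
Bałaban asserted; NOT a discharge.  N11 NOT discharged; K1⁹ NOT closed, no registered stub of v9 touched; counts unmoved (typed 28∕28 · discharged 5∕27 · A 5∕28).  One finite
`𝕋⁴_{L^K}` programme at fixed `ε = L^{−K}`; R4 closes only the conditional finite-𝕋⁴ rung `BalabanLadder.UV` — NOT ℝ⁴, NOT OS, NOT a mass gap, NOT Clay.  No `sorry`, `axiom`, `def`,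
`instance`, `notation`.  Sources (SHAPE ∕ bookkeeping only): [III] (2.1)–(2.3) pp.254–255, (2.17)–(2.18) p.257, (2.6) p.255.
-/

noncomputable section

namespace Summit.QuantumFields.YangMills.Theorems.BalabanUVNodesN11HistoryStaircaseNormalForm

open Literature.MathematicalPhysics.QuantumFieldTheory.Balaban1983to89 T4Continuum Node00 B14.Eq218Concrete
open BalabanUVNodesN11OneBlockLevels (eq_empty_or_eq_univ_of_mem_unionsOfCubes_of_le dCubeSide_dvd_or_lt)
open BalabanUVNodesN11RunGuardOfFlowControl (not_dvdAt_mono_of_flowIneq26)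

/-! ## §1  Any (2.1)-chain: the `T`-levels of `Ω` and of `Λ` are initial segments with lag at most one -/

section Staircase

variable {α : Type*} {D : ℕ → Set (Set α)} {k : ℕ}

/-- **★★ THE STAIRCASE CODES OF A HISTORY** (any (2.1)-chain; `cΩ`, `cΛ` = the last levels `≤ k` at which `Ω`, resp. `Λ`, is the whole torus, `0` if none): `Ω_j = T ⟺ j ≤ cΩ` and
`Λ_j = T ⟺ j ≤ cΛ` for `1 ≤ j ≤ k` (`Ω`, `Λ` antitone), `cΛ ≤ cΩ` (`Λ ⊆ Ω`) and `cΩ ≤ cΛ + 1` (`Ω_{j+1} ⊆ Λ_j`). [cite: Balaban1988Convergent, (2.1) p.254] -/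
theorem exists_staircase_codes (s : Seq D k) :
    ∃ cΩ cΛ : ℕ, cΩ ≤ k ∧ cΛ ≤ cΩ ∧ cΩ ≤ cΛ + 1 ∧
      (∀ j, 1 ≤ j → j ≤ k → (s.Ω j = Set.univ ↔ j ≤ cΩ)) ∧ (∀ j, 1 ≤ j → j ≤ k → (s.Λ j = Set.univ ↔ j ≤ cΛ)) := by
  classical
  -- the last `T`-level of `Ω` (resp. `Λ`), `0` if none — abstracted once, with its three defining properties
  obtain ⟨cΩ, hcΩk, hcΩspec, hcΩmax⟩ : ∃ c, c ≤ k ∧ (c ≠ 0 → 1 ≤ c ∧ s.Ω c = Set.univ) ∧ (∀ j, 1 ≤ j ∧ s.Ω j = Set.univ → j ≤ k → j ≤ c) :=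
    ⟨Nat.findGreatest (fun j => 1 ≤ j ∧ s.Ω j = Set.univ) k, Nat.findGreatest_le k,
      fun h => Nat.findGreatest_of_ne_zero rfl h, fun j hj hjk => Nat.le_findGreatest hjk hj⟩
  obtain ⟨cΛ, hcΛk, hcΛspec, hcΛmax⟩ : ∃ c, c ≤ k ∧ (c ≠ 0 → 1 ≤ c ∧ s.Λ c = Set.univ) ∧ (∀ j, 1 ≤ j ∧ s.Λ j = Set.univ → j ≤ k → j ≤ c) :=
    ⟨Nat.findGreatest (fun j => 1 ≤ j ∧ s.Λ j = Set.univ) k, Nat.findGreatest_le k,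
      fun h => Nat.findGreatest_of_ne_zero rfl h, fun j hj hjk => Nat.le_findGreatest hjk hj⟩
  have hΩiff : ∀ j, 1 ≤ j → j ≤ k → (s.Ω j = Set.univ ↔ j ≤ cΩ) := by
    intro j h1 hj
    refine ⟨fun h => hcΩmax j ⟨h1, h⟩ hj, fun h => ?_⟩
    obtain ⟨hc1, hc⟩ := hcΩspec (by omega)
    have hsub : s.Ω cΩ ⊆ s.Ω j := s.chain.Ω_antitone h1 h hcΩk
    rw [hc] at hsub
    exact Set.eq_univ_of_univ_subset hsub
  have hΛiff : ∀ j, 1 ≤ j → j ≤ k → (s.Λ j = Set.univ ↔ j ≤ cΛ) := by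
    intro j h1 hj
    refine ⟨fun h => hcΛmax j ⟨h1, h⟩ hj, fun h => ?_⟩
    obtain ⟨hc1, hc⟩ := hcΛspec (by omega)
    have hsub : s.Λ cΛ ⊆ s.Λ j := s.chain.Λ_antitone h1 h hcΛk
    rw [hc] at hsub
    exact Set.eq_univ_of_univ_subset hsub
  refine ⟨cΩ, cΛ, hcΩk, ?_, ?_, hΩiff, hΛiff⟩
  · -- `cΛ ≤ cΩ`: `Λ_{cΛ} = T ⊆ Ω_{cΛ}`
    by_cases h0 : cΛ = 0
    · rw [h0]; exact Nat.zero_le _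
    · obtain ⟨hc1, hc⟩ := hcΛspec h0
      have hsub : s.Λ cΛ ⊆ s.Ω cΛ := s.chain.Λ_subset cΛ hc1 hcΛk
      rw [hc] at hsub
      exact (hΩiff cΛ hc1 hcΛk).1 (Set.eq_univ_of_univ_subset hsub)
  · -- `cΩ ≤ cΛ + 1`: `Ω_{cΩ} = T ⊆ Λ_{cΩ − 1}`
    by_cases h2 : cΩ ≤ 1
    · omega
    · obtain ⟨hc1, hc⟩ := hcΩspec (by omega)
      obtain ⟨c, rfl⟩ : ∃ c, cΩ = c + 1 := ⟨cΩ - 1, by omega⟩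
      have hsub : s.Ω (c + 1) ⊆ s.Λ c := s.chain.Ω_succ_subset c (by omega) (Nat.lt_of_succ_le hcΩk)
      rw [hc] at hsub
      have := (hΛiff c (by omega) (by omega)).1 (Set.eq_univ_of_univ_subset hsub)
      omega

end Staircase

/-! ## §2  Binary histories are their codes; at most `2k + 1` of them -/

section Binary

variable {α : Type*} {D : ℕ → Set (Set α)} {k : ℕ}

/-- **★★ TWO BINARY HISTORIES WITH THE SAME `T`-LEVELS ARE EQUAL**: if every `Ω_j, Λ_j` (`1 ≤ j ≤ k`) of `s` and of `t` is `∅` or `T`, and `s.Ω j = T ↔ t.Ω j = T`, `s.Λ j = T ↔ t.Λ j = T`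
on the window, then `s = t` (off the window both vanish). [cite: Balaban1988Convergent, (2.1) p.254, (2.18) p.257] -/
theorem eq_of_binary_of_univ_iff (s t : Seq D k)
    (hs : ∀ j, 1 ≤ j → j ≤ k → (s.Ω j = ∅ ∨ s.Ω j = Set.univ) ∧ (s.Λ j = ∅ ∨ s.Λ j = Set.univ))
    (ht : ∀ j, 1 ≤ j → j ≤ k → (t.Ω j = ∅ ∨ t.Ω j = Set.univ) ∧ (t.Λ j = ∅ ∨ t.Λ j = Set.univ))
    (hαne : (Set.univ : Set α) ≠ ∅)
    (hΩ : ∀ j, 1 ≤ j → j ≤ k → (s.Ω j = Set.univ ↔ t.Ω j = Set.univ)) (hΛ : ∀ j, 1 ≤ j → j ≤ k → (s.Λ j = Set.univ ↔ t.Λ j = Set.univ)) :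
    s = t := by
  apply Seq.ext'
  · funext j
    by_cases hw : 1 ≤ j ∧ j ≤ k
    · rcases (hs j hw.1 hw.2).1 with h | h <;> rcases (ht j hw.1 hw.2).1 with h' | h'
      · rw [h, h']
      · exact absurd ((hΩ j hw.1 hw.2).2 h') (by rw [h]; exact fun e => hαne e.symm)
      · exact absurd ((hΩ j hw.1 hw.2).1 h) (by rw [h']; exact fun e => hαne e.symm)
      · rw [h, h']
    · rw [s.Ω_off j hw, t.Ω_off j hw]
  · funext j
    by_cases hw : 1 ≤ j ∧ j ≤ k
    · rcases (hs j hw.1 hw.2).2 with h | h <;> rcases (ht j hw.1 hw.2).2 with h' | h'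
      · rw [h, h']
      · exact absurd ((hΛ j hw.1 hw.2).2 h') (by rw [h]; exact fun e => hαne e.symm)
      · exact absurd ((hΛ j hw.1 hw.2).1 h) (by rw [h']; exact fun e => hαne e.symm)
      · rw [h, h']
    · rw [s.Λ_off j hw, t.Λ_off j hw]

/-- **★★★ AT MOST `2k + 1` BINARY HISTORIES**: if EVERY (2.18)-index of length `k` is binary on the window (`Ω_j, Λ_j ∈ {∅, T}`), the index set has at most `2k + 1` elements — the codes
`cΩ + cΛ ∈ {0, …, 2k}` (§1: `cΛ ≤ cΩ ≤ cΛ + 1 ≤ k + 1`) separate histories.  (On a nonempty finite lattice.) [cite: Balaban1988Convergent, (2.1) p.254, (2.18) p.257] -/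
theorem card_le_of_binary [Finite α] [Nonempty α]
    (hbin : ∀ s : Seq D k, ∀ j, 1 ≤ j → j ≤ k → (s.Ω j = ∅ ∨ s.Ω j = Set.univ) ∧ (s.Λ j = ∅ ∨ s.Λ j = Set.univ)) :
    Fintype.card (Seq D k) ≤ 2 * k + 1 := by
  classical
  have hαne : (Set.univ : Set α) ≠ ∅ := Set.univ_nonempty.ne_empty
  -- the code of a history
  have hcode : ∀ s : Seq D k, ∃ n : Fin (2 * k + 1), ∃ cΩ cΛ : ℕ, (n : ℕ) = cΩ + cΛ ∧ cΛ ≤ cΩ ∧ cΩ ≤ cΛ + 1 ∧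
      (∀ j, 1 ≤ j → j ≤ k → (s.Ω j = Set.univ ↔ j ≤ cΩ)) ∧ (∀ j, 1 ≤ j → j ≤ k → (s.Λ j = Set.univ ↔ j ≤ cΛ)) := by
    intro s
    obtain ⟨cΩ, cΛ, hk, h1, h2, hΩ, hΛ⟩ := exists_staircase_codes s
    exact ⟨⟨cΩ + cΛ, by omega⟩, cΩ, cΛ, rfl, h1, h2, hΩ, hΛ⟩
  choose f hf using hcode
  have hinj : Function.Injective f := by
    intro s t hst
    obtain ⟨cΩ, cΛ, hn, h1, h2, hΩ, hΛ⟩ := hf s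
    obtain ⟨cΩ', cΛ', hn', h1', h2', hΩ', hΛ'⟩ := hf t
    have hsum : cΩ + cΛ = cΩ' + cΛ' := by rw [← hn, ← hn', hst]
    have hcΩ : cΩ = cΩ' := by omega
    have hcΛ : cΛ = cΛ' := by omega
    subst hcΩ hcΛ
    exact eq_of_binary_of_univ_iff s t (hbin s) (hbin t) hαne
      (fun j hj1 hjk => (hΩ j hj1 hjk).trans (hΩ' j hj1 hjk).symm) (fun j hj1 hjk => (hΛ j hj1 hjk).trans (hΛ' j hj1 hjk).symm)
  simpa using Fintype.card_le_of_injective f hinj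

end Binary

/-! ## §3  Sequences of record on an all-one-block run -/

section Record

variable {F : T4Family} {N : ℕ} [NeZero N]

/-- **★★★ ON AN ALL-ONE-BLOCK RUN THE (2.18) INDEX SET OF LENGTH `k` HAS AT MOST `2k + 1` ELEMENTS**: if every 𝐃_j-cube of record, `1 ≤ j ≤ k`, exceeds the torus period, every
history is binary (p618164's `∅ ∕ T` dichotomy at each level; cf. `…OneBlockTailHistories`) and §2 applies. [cite: Balaban1988Convergent, (2.1) p.254, (2.17)–(2.18) p.257] -/
theorem card_seqOfRecord_le_of_allOneBlock {ν : Stage7Numerics} {M : ℕ} {g : ℕ → ℝ} {K k : ℕ}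
    (hone : ∀ j, 1 ≤ j → j ≤ k → (F.P K).sitesPerDir 0 ≤ dCubeSide (F.P K).L M (RkOfRecord (F.P K).L ν.r (g j)) j) :
    Fintype.card (SeqOfRecord F ν M g K k) ≤ 2 * k + 1 :=
  card_le_of_binary fun s j h1 hj =>
    ⟨eq_empty_or_eq_univ_of_mem_unionsOfCubes_of_le (hone j h1 hj) (s.chain.memΩ j h1 hj),
      eq_empty_or_eq_univ_of_mem_unionsOfCubes_of_le (hone j h1 hj) (s.chain.memΛ j h1 hj)⟩

/-- **★★★ A (2.6)-RUN WHOSE FIRST LEVEL IS ONE-BLOCK: `ρ_k`'s (2.18) REPRESENTATION HAS AT MOST `2k + 1` TERMS** (generic θ, `M = L^a`, `r = 1`, window `]0, γ]`, (2.6) with `0 ≤ β⁺`,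
`β⁺·γ² ≤ 1`; the families entirely below the floor): for every `k ≤ K`, `Fintype.card (SeqOfRecord … k) ≤ 2k + 1`. [cite: Balaban1988Convergent, (2.6) p.255, (2.1) p.254, (2.17)–(2.18) p.257; Balaban1987RG1, (0.1) p.251] -/
theorem card_seqOfRecord_le_of_not_dvd_one_of_flowIneq26 (θ : Stage13Params F N) {a : ℕ} (hM : θ.τ9.M = F.L ^ a) (hr : θ.ν.r = 1)
    (p : B12.RunParams) {γ βup β₀ : ℝ} (hβ : 0 ≤ βup) (hβγ : βup * γ ^ 2 ≤ 1)
    (hW : Step.InInterval γ p.K (gOfRecord₁₃ F N θ p))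
    (h26 : B14.FlowIneq26 (gOfRecord₁₃ F N θ p) βup β₀ p.K)
    (h1 : ¬ dCubeSide (F.P p.K).L θ.τ9.M (RkOfRecord (F.P p.K).L θ.ν.r (gOfRecord₁₃ F N θ p 1)) 1 ∣ (F.P p.K).sitesPerDir 0)
    {k : ℕ} (hk : k ≤ p.K) :
    Fintype.card (SeqOfRecord F θ.ν θ.τ9.M (gOfRecord₁₃ F N θ p) p.K k) ≤ 2 * k + 1 :=
  card_seqOfRecord_le_of_allOneBlock fun j hj1 hjk =>
    ((dCubeSide_dvd_or_lt θ hM p j).resolve_left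
      (not_dvdAt_mono_of_flowIneq26 θ hM hr p hβ hβγ hW h26 le_rfl hj1 (hjk.trans hk) h1)).le

end Record

end Summit.QuantumFields.YangMills.Theorems.BalabanUVNodesN11HistoryStaircaseNormalForm

end
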